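import Summits.QuantumFields.YangMills.Theorems.BalabanUVNodesK0RecordFormatNamesFluctRatioC
import Literature.MathematicalPhysics.QuantumFieldTheory.Balaban1983to89.B12Eq216GaussianCarrier

/-!
# K0⁷ — THE RECORD-SIDE FORMAT NAMES, EDITION 27 = FLUCTUATION CARRIERS, STAGE 1b: THE RECORD's FLUCTUATION GAUSSIAN AS A TOTAL OBJECT AND THE `FluctData` SOCKET
# (= §24l of the g36 draft `ym-nodeO-def-1/g36/…FluctF.v2-blocked-unbuilt.lean` 7fd74e276b932a8c, re-read against today's tree; SUMMON-CONDITIONS v9 item 4; the cut-off PINNED per the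
# DESIGN WORD OF RECORD nodeO STATUS 2026-08-31 l.5531 (D1): `χ_k := chiFluctPrinted ε₁` through `FluctData.onBondsPrinted` — the g36 all-bonds `onBonds` choice WITHDRAWN)

Cell `ym-nodeO-ideate` ∕ `ym-balaban-port`, DEFINER seat `ym-nodeO-def-1` (gen 39); `--kind definition --supports stmt-QuantumFields-20541 --as helper`; count-neutral.
[I] = [Balaban1987RG1].

WHY.  Stage 2's CLOSED carrier `recordFluctInt` (= print's (2.13) `𝐄^{(k+1)}(g_k, U_{k+1}(W_B))` at the record) is `recordFluctIntOf … 𝐏_rec curly_rec` — one line once the exponents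
(o1)–(o4) exist.  THIS FILE is the part of the socket that needs the (now built) Gaussian carrier `B12Eq216GaussianCarrier`: the record Gaussian `dμ_{C^{(k)}(U_{k+1}(W_B))}` as a TOTAL
measure on print's carrier `VecField (F.P K) k fluctG3` and the `FluctData` socket with the two exponents as PARAMETERS.  Stage 1 (§24k `recordCt ∕ recordVpot`, ✓`…FluctF`) and
stage 1c (§24m the complex Lebesgue-reference ratio + `chiRem`, ✓`…FluctRatioC`) are in the tree; nothing of them is touched.

WHAT THIS FILE IS (definitions + one probability-instance lemma + `rfl` faces; NEW names):
* §24l `idxEquiv3 : Fin 3 ≃ Idx fluctG3`; `recordCopFluct Vk : Matrix (FluctIdx) (NonB0Idx) ℝ` (ed.15e's graph elimination `C` re-rowed on `FluctIdx`: identity block off `range recordB0`,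
  `−X` rows on it); `recordCopκ` (the carrier's row convention `PBond × Idx 𝔤`); ★ `recordFluctMeasure F a₀ ε₂₉ k K B : Measure (VecField (F.P K) k fluctG3)` — `gaussFieldPush (recordCopκ …)
  (recordPreckLoc … (portVkAx … B) (hopLinGraph …))` WHEN that precision is `PosDef`, ELSE `Measure.dirac 0` (TOTAL; the junk branch SAID; the guard is (P5)'s first conjunct of
  `P0CarrierClauses` BY NAME — DESIGN WORD (D4)); `isProbabilityMeasure_recordFluctMeasure`; ★ SOCKET `recordFluctDataOf F a₀ ε₂₉ k K ε₁ Pk Qk : FluctData (recordW F a₀ ε₂₉ k K)` :=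
  `FluctData.onBondsPrinted (recordFluctMeasure …) … ε₁ Pk Qk` — print's (2.9) cut-off over `b ∉ {b₀(c)}`, a function of the chart variable `B′` ALONE (`recordFluctDataOf_χ`, `rfl`; on the
  remaining variables it is ✓`chiRem` by ✓`chiFluctPrinted_eq_chiRem`); ★ `recordFluctIntOf … Pk Qk g B := (recordFluctDataOf …).newTerm g B` (= (2.13) for THOSE exponents); faces
  `recordFluctDataOf_μ`, `recordFluctDataOf_χ`.
NOT HERE (stage 2, BLOCKED-ON (o1)–(o4)): the exponents `𝐏^{(k)}_rec ∕ {…}_rec`, the closed `recordFluctInt`, and the bridge to ✓`recordFluctRatioC` (◆ (R-b): a theorem then, never a letter).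

HONEST FRAMING.  Definitions only (+ one probability-measure instance lemma and `rfl` faces); NOTHING of Bałaban is asserted, ported or discharged; the Gaussian's `dite` ELSE-branch is
JUNK off positivity of `recordPreckLoc` — SAID — and positivity is (P5)∕[15]-Hessian content displayed by consumers; `stub_FE` (XXL) ∕ `stub_P0C` OPEN, ⟨27930⟩ OPEN (1∕3); K0⁷ ∕ K0ᴬ ∕
K1ᴬ ∕ K3ᴬ OPEN; NODE O not inhabited (0∕1); COUNT 8∕28 · K 1∕4 UNMOVED; finite `𝕋⁴_{L^K}` at fixed ε — NOT continuum ∕ ℝ⁴ ∕ OS; **the Yang–Mills mass gap (Clay) is NOT proved by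
any of this.**  No `sorry`, `instance`, `notation`; standard axioms.
-/

noncomputable section

open scoped BigOperators Matrix.Norms.L2Operator

namespace Summit.QuantumFields.YangMills.Theorems.K0RecordFormatNames

open Literature.MathematicalPhysics.QuantumFieldTheory.Balaban1983to89
open Literature.MathematicalPhysics.QuantumFieldTheory.Balaban1983to89.Node00
open Literature.MathematicalPhysics.QuantumFieldTheory.Balaban1983to89.T4Continuum (T4Family)
open Summit.QuantumFields.YangMills.Theorems.BalabanUVNodesPortS1 (portVkAx hopLinGraph)

variable (F : T4Family)

/-! ## §24l  The record's fluctuation Gaussian (total) and the `FluctData` socket -/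


/-- `Fin 3 ≃ Idx fluctG3` (`Idx V = Fin (finrank ℝ V)`, `finrank ℝ ℝ³ = 3`). [cite: Balaban1987RG1, (2.4) p.266 (bookkeeping)] -/
def idxEquiv3 : Fin 3 ≃ B1Eq221Coordinates.Idx fluctG3 :=
  finCongr (by rw [finrank_euclideanSpace, Fintype.card_fin])

/-- **The elimination operator `C` RE-ROWED ON `FluctIdx`** (ed.15e's graph coordinates `recordCopLoc = fromRows (−recordXLoc) 1` over `CoarseIdx ⊕ NonB0Idx`, read back on the plain
fluctuation index: at a `b₀(c)`-bond row the `−X` block through the coarse bond `c` with `recordB0 c = i.1` (`Classical.choose`, as ▶ PT-A-1's ✓ `hopLinGraph` does), elsewhere the identity block).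
No standing-range hypothesis is needed for the DEFINITION (on the range `recordB0` is injective and this is `recordCopLoc ∘ blkToFluct⁻¹`). [cite: Balaban1987RG1, p.268 («B′ = CB»), p.267 (h, b₀(c))] -/
def recordCopFluct (k K : ℕ) (Vk : GaugeField (F.P K) k (SU 2)) : Matrix (FluctIdx F k K) (NonB0Idx F k K) ℝ :=
  fun i j => if h : i.1 ∈ Set.range (recordB0 F k K) then -(recordXLoc F k K Vk (h.choose, i.2) j)
    else if (⟨i, h⟩ : NonB0Idx F k K) = j then 1 else 0

/-- The same in the Gaussian carrier's row convention `PBond × Idx 𝔤`. [cite: Balaban1987RG1, p.268 (bookkeeping)] -/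
def recordCopκ (k K : ℕ) (Vk : GaugeField (F.P K) k (SU 2)) : Matrix (PBond (F.P K) k × B1Eq221Coordinates.Idx fluctG3) (NonB0Idx F k K) ℝ :=
  Matrix.reindex (Equiv.prodCongr (Equiv.refl _) idxEquiv3) (Equiv.refl _) (recordCopFluct F k K Vk)

open Classical in
/-- ★ **THE RECORD's FLUCTUATION GAUSSIAN `dμ_{C^{(k)}(U_{k+1}(W_B))}` AS A TOTAL OBJECT** on print's carrier `VecField (F.P K) k fluctG3`: the push-forward `B′ = C·B` of the centred Gaussian with precision
`C*Δ^{(k)}C = recordPreckLoc … (portVkAx … B) (hopLinGraph …)` (ed.15e∕▶ PT-A-1's letters, `εbg := a₀`) WHEN that precision is positive-definite; ELSE the Dirac mass at `0` — a JUNK branch, SAID (positivity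
is [15]-Hessian∕(β) content, displayed by consumers; nothing asserted here). [cite: Balaban1987RG1, p.268 («covariance C^{(k)}(U_{k+1}) = (C*Δ^{(k)}C)⁻¹»), (2.11)–(2.13) pp.267–268] -/
def recordFluctMeasure (a₀ ε₂₉ : ℝ) (k K : ℕ) (B : recordW F a₀ ε₂₉ k K) : MeasureTheory.Measure (VecField (F.P K) k fluctG3) :=
  if (recordPreckLoc F k K a₀ (portVkAx F a₀ ε₂₉ k K B) (hopLinGraph F k K (portVkAx F a₀ ε₂₉ k K B))).PosDef then
    B12Eq216GaussianCarrier.gaussFieldPush (recordCopκ F k K (portVkAx F a₀ ε₂₉ k K B))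
      (recordPreckLoc F k K a₀ (portVkAx F a₀ ε₂₉ k K B) (hopLinGraph F k K (portVkAx F a₀ ε₂₉ k K B)))
  else MeasureTheory.Measure.dirac 0

open Classical in
/-- Either branch is a probability measure (the Gaussian by `isProbabilityMeasure_gaussFieldPush`, the junk branch trivially). [cite: Balaban1987RG1, (2.12)–(2.13) p.268 (bookkeeping)] -/
theorem isProbabilityMeasure_recordFluctMeasure (a₀ ε₂₉ : ℝ) (k K : ℕ) (B : recordW F a₀ ε₂₉ k K) :
    MeasureTheory.IsProbabilityMeasure (recordFluctMeasure F a₀ ε₂₉ k K B) := by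
  unfold recordFluctMeasure
  split_ifs with h
  · exact B12Eq216GaussianCarrier.isProbabilityMeasure_gaussFieldPush _ h
  · infer_instance

/-- ★ **SOCKET — the record `FluctData` with the two exponents as parameters**: print's carrier `VecField`, its PRINTED (2.9) cut-off `chiFluctPrinted ε₁` (product over `b ∉ {b₀(c)}`; DESIGN WORD (D1): a function of `B′` alone, `C`-free on the remaining variables), the record Gaussian above, and `Pk Qk` = print's `𝐏^{(k)}` and
curly bracket `{…}` as EXPLICIT PARAMETERS (stage 2 pins them: `recordFluctData := recordFluctDataOf … 𝐏_rec curly_rec`).  Index `X := recordW F a₀ ε₂₉ k K` (the charted datum `B`; every record object is a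
function of `B` through `U_{k+1}(W_B)`). [cite: Balaban1987RG1, (2.9) p.266, (2.12)–(2.13) p.268] -/
def recordFluctDataOf (a₀ ε₂₉ : ℝ) (k K : ℕ) (ε₁ : ℝ) (Pk Qk : ℝ → recordW F a₀ ε₂₉ k K → VecField (F.P K) k fluctG3 → ℝ) :
    B12Eq213Body268.FluctData (recordW F a₀ ε₂₉ k K) :=
  B12Eq213Body268.FluctData.onBondsPrinted (recordFluctMeasure F a₀ ε₂₉ k K) (isProbabilityMeasure_recordFluctMeasure F a₀ ε₂₉ k K) ε₁ Pk Qk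

/-- ★ **SOCKET — `recordFluctIntOf … Pk Qk g B := (recordFluctDataOf …).newTerm g B`** = (2.13) `𝐄^{(k+1)}(g, U_{k+1}(W_B)) = log ∫ χ_k exp[Pk + Qk] dμ_{C^{(k)}(U_{k+1}(W_B))}` FOR THE GIVEN EXPONENTS.
Stage 2's closed `recordFluctInt F Mc a₀ ε₂₉ k v n` (▶ PT-A-1's §1 signature) := `recordFluctIntOf F a₀ ε₂₉ k (recordK₀ F Mc k + n) ε₁ 𝐏_rec curly_rec (g_k)`. [cite: Balaban1987RG1, (2.13) p.268] -/
def recordFluctIntOf (a₀ ε₂₉ : ℝ) (k K : ℕ) (ε₁ : ℝ) (Pk Qk : ℝ → recordW F a₀ ε₂₉ k K → VecField (F.P K) k fluctG3 → ℝ) (g : ℝ)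
    (B : recordW F a₀ ε₂₉ k K) : ℝ :=
  (recordFluctDataOf F a₀ ε₂₉ k K ε₁ Pk Qk).newTerm g B

/-- FACE: the socket's measure IS the record Gaussian (definitional). [cite: Balaban1987RG1, (2.12) p.268 (bookkeeping)] -/
theorem recordFluctDataOf_μ (a₀ ε₂₉ : ℝ) (k K : ℕ) (ε₁ : ℝ) (Pk Qk : ℝ → recordW F a₀ ε₂₉ k K → VecField (F.P K) k fluctG3 → ℝ) (B : recordW F a₀ ε₂₉ k K) :
    (recordFluctDataOf F a₀ ε₂₉ k K ε₁ Pk Qk).μ B = recordFluctMeasure F a₀ ε₂₉ k K B := rfl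

/-- FACE (`rfl`): the socket's cut-off IS print's PRINTED (2.9) characteristic function of the chart variable `B′` ALONE — the datum slot is ignored (DESIGN WORD (D1); on the remaining
variables it reads ✓`chiRem` by ✓`chiFluctPrinted_eq_chiRem`). [cite: Balaban1987RG1, (2.9) p.266 (bookkeeping)] -/
theorem recordFluctDataOf_χ (a₀ ε₂₉ : ℝ) (k K : ℕ) (ε₁ : ℝ) (Pk Qk : ℝ → recordW F a₀ ε₂₉ k K → VecField (F.P K) k fluctG3 → ℝ) (B : recordW F a₀ ε₂₉ k K)
    (B' : VecField (F.P K) k fluctG3) :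
    (recordFluctDataOf F a₀ ε₂₉ k K ε₁ Pk Qk).χ B B' = B12SmallFieldDomain259.chiFluctPrinted ε₁ B' := rfl

end Summit.QuantumFields.YangMills.Theorems.K0RecordFormatNames

end
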